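import Literature.AlgebraicGeometry.ModuliOfAbelianVarieties.SiegelFamilyRealPointsCocycleSign
import Literature.NumberTheory.ModularForms.SiegelCongruenceSubgroups
import HarnessLib

/-!
# Goresky–Tai's divisibility lemma `τ(g)g⁻¹ ∈ Γ(2m)`, `τ(g)g ∈ Γ(4m)` and its moduli consequence: a
# `Γ_g(2)`-real period point with `Stab_{Γ_g}(Z) = ±1` is a COCYCLE point (`τ(γ)γ = 1`), so `(X_Z, E_Z)`
# is real and `Z ∈ Γ_g · H'_g`; Shimura's points of `𝔜_j` are not `Γ_g(2)`-real
# (Goresky–Tai 2003, §4 Lemma 9, Prop. 10, Cor. 11, §7.2; Shimura 1972 §3)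

Topic `Literature/AlgebraicGeometry/ModuliOfAbelianVarieties` (the Siegel-family files, namespace
`Literature.AlgebraicGeometry.ModuliOfAbelianVarieties.SiegelModuli`).  Lane `lit-hodgefound` (Track 2
foundations library), prover seat p15 generation 51, row g51-#4, on top of g51-#3
`SiegelFamilyRealPointsCocycleSign` (at `End(X_Z) = ℤ` points the sign `τ(γ)γ = ±1` is an invariant of
the point; `−1` on `𝔜_j`), g51-#1/#2 (cocycle ⟺ `E_Z`-compatible real structure ⟺ `Z ∈ Γ_g · H'_g`) and
the tree's principal congruence subgroups `siegelPrincipalGamma n q = Γⁿ(q) ⊂ Sp_{2n}(ℤ)`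
(`SiegelCongruenceSubgroups`, row A2-267).  THEOREMS ONLY: no definition, no instance, no notation, no
named fact (net Literature debt `0`), no `sorry`.

## Source, VERBATIM

M. Goresky, Y. S. Tai, *The moduli space of real abelian varieties with level structure*, Compositio
Math. **139** (2003) = arXiv:math/0108103, held `paper:arxiv-math_0108103`, §4 p0007–p0008:
«**Lemma 9.** Let `g ∈ Sp(2n, ℤ)`.  Fix `m ≥ 1`.  (1) If `g ∈ Γ(m)` then `g̃g⁻¹ ∈ Γ(2m)`.  (2) If
`g ∈ Γ(2m)` then `g̃g ∈ Γ(4m)`.  (3) If `g̃g⁻¹ ∈ Γ(4m)` then `g = βu` for some `β ∈ Γ_{2m}(2)` and for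
some `u ∈ GL(n, ℤ)`.  Proof.  Let `g = (A B; C D)`.  Since `g̃ = g − (0 2B; 2C 0)` we have
`g̃g⁻¹ = I − (−2BᵗC 2BᵗA; 2CᵗD −2CᵗA)`.  This gives part (1).  If `g = I + 2mg′` then `g̃ + g` is even,
and `g̃g = I + 2m(g̃′ + g′) + 4m²g̃′g` which proves part (2).»
«**Proposition 10.** Let `γ ∈ Γ(2)` and suppose that `Z ∈ 𝔥_n` is not fixed by any element of
`Sp(2n, ℤ)` other than `±I`.  Suppose that `Z̃ = γZ`.  Then there exists `h ∈ Sp(2n, ℤ)` such that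
`γ = h̃h⁻¹`, hence `𝔥_n^γ = h · iC_n`.»  «**Corollary 11.** Suppose `γ ∈ Γ(4m)` and `𝔥_n^γ ≠ ∅`.  Then
there exists `g ∈ Γ_{2m}(2)` such that `γ = g̃g⁻¹`.»  §7.2 p0012: «so the following element
`γ⁻¹τ(hT_X)(hT_X)⁻¹` fixes `Z`.  By our assumption on `Z`, this implies that `γ = ±I τ(hT_X)(hT_X)⁻¹`
or, `±T_{−2X} = h̃⁻¹γh = (h̃⁻¹h)(h⁻¹γh) ∈ Γ(2).Γ(4m)` (using Lemma 9 and the fact that `Γ(4m)` is normal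
in `Sp(2n, ℤ)`).»  §4.5 p0008 (proof of Lemma 12): «By lemma 9, `θ ∈ Γ(4m)` which is torsion-free.  So
`θ = I`»; §8.2 p0015: «`Γ(4)` which is torsion-free».

Here `τ(g) = g̃ = I₋ g I₋`, `I₋ = (−1 0; 0 1)` (§2.2), `Γ(N) = {γ ∈ Sp(2n, ℤ) | γ ≡ I (mod N)}` (§4.1) — the
tree's `siegelPrincipalGamma n N` (`mem_siegelPrincipalGamma_iff_forall`).

## What is proved (`K = (−1 0; 0 1) ∈ M_{2n}(ℤ)`, `τ(g) = KgK`; `Γ_g = siegelModularGroup g ⊂ Sp_{2g}(ℝ)`)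

* §1 `mem_siegelPrincipalGamma_iff_dvd` (`g ∈ Γ(q) ⟺ q ∣ (g − 1)_{ij}` for all `i, j`),
  `conjK_mul_mul_conjK_apply` (`(KgK)_{ij} = ε_i g_{ij} ε_j`, `ε = (−1,…,−1,1,…,1)`),
  **`conjK_mul_mul_conjK_mem_siegelPrincipalGamma`** (`τ(Γ(q)) = Γ(q)`),
  `coe_ne_neg_one_of_mem_siegelPrincipalGamma` (`−I ∉ Γ(q)` for `q ≥ 3`).
* §2 LEMMA 9 (1), (2): **`dvd_conjK_mul_mul_conjK_mul_sub_one_of_mul_eq_one`** (`g ≡ I (m)`, `gg′ = I` ⟹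
  `τ(g)g′ ≡ I (2m)`), **`dvd_conjK_mul_mul_conjK_mul_self_sub_one`** (`g ≡ I (2m)` ⟹ `τ(g)g ≡ I (4m)`),
  and the subgroup forms **`conjK_mul_inv_mem_siegelPrincipalGamma`** (`τ(g)g⁻¹ ∈ Γ(2m)`),
  **`conjK_mul_self_mem_siegelPrincipalGamma`** (`τ(g)g ∈ Γ(4m)`); `conjK_mul_self_ne_neg_one_of_level_two`
  (`g ∈ Γ(2)`, `n ≥ 1` ⟹ `τ(g)g ≠ −I`).
* §3 THE MODULI CONSEQUENCE (the step of Prop. 10 / Cor. 11 / §7.2 that decides the sign):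
  **`iStar_mul_self_eq_one_of_mem_siegelPrincipalGamma_two`** — if `Stab_{Γ_g}(Z) ⊆ {±1}` («not fixed by
  any element of `Sp(2n, ℤ)` other than `±I`»), `γ ∈ Γ_g(2)` and `γ • Z = −Z̄`, then `τ(γ)·γ = 1`
  (`τ(γ)γ ∈ Stab(Z) ∩ Γ(4) = {±I} ∩ Γ(4) = {I}`); hence (g51-#1, g51-#2) `(X_Z, E_Z)` carries an
  `E_Z`-compatible real structure and `Z ∈ Γ_g · H'_g` (`…_of_end_eq_smul_one`, `…_of_hodgeGeneral`
  versions: `exists_realStructure_siegelForm_real_of_mem_siegelPrincipalGamma_two_…`,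
  `exists_smul_two_mul_re_of_mem_siegelPrincipalGamma_two_…`).
* §4 SHIMURA'S POINTS ARE NOT `Γ_g(2)`-REAL: **`not_exists_mem_siegelPrincipalGamma_two_smul_eq_negConj_of_blockRel`**
  — for `Z ∈ 𝔜_j` with `End(X_Z) = ℤ` no `γ ∈ Γ_g(2)` has `γ • Z = −Z̄` (g51-#3: there the sign is `−1`);
  so the real point `[Z] ∈ 𝔄_g(ℝ)` without real model has no real lift to the level-2 cover, in line with
  Theorem 8 / Cor. 11 («`X_ℝ = Γ(4m)∖S` consists of finitely many copies of `Γ_ℓ(4m)∖C_n`»: at level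
  `4m` every real point comes from a real abelian variety).

## References

* [GoreskyTai2003RealModuli] M. Goresky, Y. S. Tai, Compositio Math. 139 (2003) 1–27, §2.2, §4 Lemma 9,
  Prop. 10, Cor. 11, Thm. 8, §7.2.
* [Shimura1972FieldOfRationality] G. Shimura, Nagoya Math. J. 45 (1972) 167–178, §3 Prop. 10–12, Thm. 2.
* [AndrianovZhuravlev2015] A. N. Andrianov, V. G. Zhuravlev, *Modular Forms and Hecke Operators*, Ch. 2
  §2.1 (2.1) (the principal congruence subgroup `Γⁿ(q)`).
* [Silhol1989] R. Silhol, *Real Algebraic Surfaces*, LNM 1392 (1989), Ch. IV §4, p. 58.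
-/

noncomputable section

open scoped Manifold Matrix ComplexConjugate
open Matrix Function

namespace Literature.AlgebraicGeometry.ModuliOfAbelianVarieties

namespace SiegelModuli

open Literature.NumberTheory.Automorphic (siegelUpperHalfSpace)
open Literature.NumberTheory.ModularForms.SiegelUpperHalfSpace (symplecticIntHom siegelModularGroup)
open Literature.NumberTheory.ModularForms.SiegelModularForm (siegelPrincipalGamma mem_siegelPrincipalGamma_iff_forall)
open Literature.Geometry.Kaehler Literature.Geometry.Kaehler.ComplexTorus

variable {n : ℕ}

/-! ## §0 The sign vector `ε` of `K = (−1 0; 0 1)` -/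

/-- `K = diag(ε)`, `ε = (−1,…,−1, 1,…,1)`. [folklore] -/
private theorem conjK_eq_diagonal_g51d :
    Matrix.fromBlocks (-1 : Matrix (Fin n) (Fin n) ℤ) 0 0 (1 : Matrix (Fin n) (Fin n) ℤ) =
      Matrix.diagonal (Sum.elim (fun _ : Fin n ↦ (-1 : ℤ)) (fun _ : Fin n ↦ (1 : ℤ))) := by
  ext (i | i) (j | j)
  · by_cases h : i = j
    · subst h; simp
    · simp [Matrix.one_apply_ne h, h]
  · simp
  · simp
  · by_cases h : i = j
    · subst h; simp
    · simp [Matrix.one_apply_ne h, h]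

/-- `ε_i² = 1`. [folklore] -/
private theorem sign_mul_self_g51d (i : Fin n ⊕ Fin n) :
    Sum.elim (fun _ : Fin n ↦ (-1 : ℤ)) (fun _ : Fin n ↦ (1 : ℤ)) i *
      Sum.elim (fun _ : Fin n ↦ (-1 : ℤ)) (fun _ : Fin n ↦ (1 : ℤ)) i = 1 := by
  rcases i with i | i <;> simp

/-- `ε_i ε_j − 1 ∈ {0, −2}` is even. [folklore] -/
private theorem two_dvd_sign_mul_sign_sub_one_g51d (i j : Fin n ⊕ Fin n) :
    (2 : ℤ) ∣ Sum.elim (fun _ : Fin n ↦ (-1 : ℤ)) (fun _ : Fin n ↦ (1 : ℤ)) i *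
      Sum.elim (fun _ : Fin n ↦ (-1 : ℤ)) (fun _ : Fin n ↦ (1 : ℤ)) j - 1 := by
  rcases i with i | i <;> rcases j with j | j <;> norm_num

/-- `ε_i ε_j + 1 ∈ {0, 2}` is even. [folklore] -/
private theorem two_dvd_sign_mul_sign_add_one_g51d (i j : Fin n ⊕ Fin n) :
    (2 : ℤ) ∣ Sum.elim (fun _ : Fin n ↦ (-1 : ℤ)) (fun _ : Fin n ↦ (1 : ℤ)) i *
      Sum.elim (fun _ : Fin n ↦ (-1 : ℤ)) (fun _ : Fin n ↦ (1 : ℤ)) j + 1 := by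
  rcases i with i | i <;> rcases j with j | j <;> norm_num

/-- `(ε_i ε_j − 1)·δ_{ij} = 0`. [folklore] -/
private theorem sign_mul_sign_sub_one_mul_one_apply_g51d (i j : Fin n ⊕ Fin n) :
    (Sum.elim (fun _ : Fin n ↦ (-1 : ℤ)) (fun _ : Fin n ↦ (1 : ℤ)) i *
        Sum.elim (fun _ : Fin n ↦ (-1 : ℤ)) (fun _ : Fin n ↦ (1 : ℤ)) j - 1) *
      (1 : Matrix (Fin n ⊕ Fin n) (Fin n ⊕ Fin n) ℤ) i j = 0 := by
  by_cases h : i = j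
  · subst h; rw [sign_mul_self_g51d, sub_self, zero_mul]
  · rw [Matrix.one_apply_ne h, mul_zero]

/-- The real extension of `K` is `I_*`. [folklore] -/
private theorem conjK_map_castRingHom_g51d :
    (Matrix.fromBlocks (-1 : Matrix (Fin n) (Fin n) ℤ) 0 0 (1 : Matrix (Fin n) (Fin n) ℤ)).map (Int.castRingHom ℝ) =
      Matrix.fromBlocks (-1 : Matrix (Fin n) (Fin n) ℝ) 0 0 (1 : Matrix (Fin n) (Fin n) ℝ) := by
  ext (i | i) (j | j) <;> simp [Matrix.one_apply]

/-! ## §1 `Γ(q)` entrywise, `τ(g)_{ij} = ε_i g_{ij} ε_j`, `τ(Γ(q)) = Γ(q)`, `−I ∉ Γ(q)` (`q ≥ 3`) -/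

/-- **`g ∈ Γ(q) ⟺ g ≡ I (mod q)` entrywise as a divisibility**: `q ∣ (g − I)_{ij}` for all `i, j` (the
tree's `Γⁿ(q)` is the kernel of reduction modulo `q`). [cite: GoreskyTai2003RealModuli, §4.1 («`Γ(N) = {γ ∈ Γ(1) | γ ≡ I (mod N)}`»)] [cite: AndrianovZhuravlev2015, Ch. 2 §2.1 (2.1)] -/
theorem mem_siegelPrincipalGamma_iff_dvd {q : ℕ} {M : Matrix.symplecticGroup (Fin n) ℤ} :
    M ∈ siegelPrincipalGamma n q ↔
      ∀ i j, (q : ℤ) ∣ ((M : Matrix (Fin n ⊕ Fin n) (Fin n ⊕ Fin n) ℤ) - 1) i j := by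
  rw [mem_siegelPrincipalGamma_iff_forall]
  refine forall_congr' fun i ↦ forall_congr' fun j ↦ ?_
  rw [Matrix.sub_apply, ← ZMod.intCast_eq_intCast_iff_dvd_sub, eq_comm]
  by_cases h : i = j
  · subst h; simp
  · simp [Matrix.one_apply_ne h]

/-- **`τ(g)_{ij} = (KgK)_{ij} = ε_i g_{ij} ε_j`** («`τ(A B; C D) = (A −B; −C D)`», i.e. «`g̃ = g − (0 2B; 2C 0)`»).
[cite: GoreskyTai2003RealModuli, §2.2 and §4.3 proof of Lemma 9] -/
theorem conjK_mul_mul_conjK_apply (M : Matrix (Fin n ⊕ Fin n) (Fin n ⊕ Fin n) ℤ) (i j : Fin n ⊕ Fin n) :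
    (Matrix.fromBlocks (-1 : Matrix (Fin n) (Fin n) ℤ) 0 0 (1 : Matrix (Fin n) (Fin n) ℤ) * M *
        Matrix.fromBlocks (-1 : Matrix (Fin n) (Fin n) ℤ) 0 0 (1 : Matrix (Fin n) (Fin n) ℤ)) i j =
      Sum.elim (fun _ : Fin n ↦ (-1 : ℤ)) (fun _ : Fin n ↦ (1 : ℤ)) i * M i j *
        Sum.elim (fun _ : Fin n ↦ (-1 : ℤ)) (fun _ : Fin n ↦ (1 : ℤ)) j := by
  rw [conjK_eq_diagonal_g51d, Matrix.mul_diagonal, Matrix.diagonal_mul]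

/-- `(τ(g) − I)_{ij} = ε_i (g − I)_{ij} ε_j`. [cite: GoreskyTai2003RealModuli, §2.2 and §4.3] -/
theorem conjK_mul_mul_conjK_sub_one_apply (M : Matrix (Fin n ⊕ Fin n) (Fin n ⊕ Fin n) ℤ) (i j : Fin n ⊕ Fin n) :
    (Matrix.fromBlocks (-1 : Matrix (Fin n) (Fin n) ℤ) 0 0 (1 : Matrix (Fin n) (Fin n) ℤ) * M *
          Matrix.fromBlocks (-1 : Matrix (Fin n) (Fin n) ℤ) 0 0 (1 : Matrix (Fin n) (Fin n) ℤ) - 1) i j =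
      Sum.elim (fun _ : Fin n ↦ (-1 : ℤ)) (fun _ : Fin n ↦ (1 : ℤ)) i * (M - 1) i j *
        Sum.elim (fun _ : Fin n ↦ (-1 : ℤ)) (fun _ : Fin n ↦ (1 : ℤ)) j := by
  rw [Matrix.sub_apply, conjK_mul_mul_conjK_apply, Matrix.sub_apply, mul_sub, sub_mul]
  congr 1
  by_cases h : i = j
  · subst h
    rw [Matrix.one_apply_eq, mul_one, sign_mul_self_g51d]
  · rw [Matrix.one_apply_ne h, mul_zero, zero_mul]

/-- **`τ` preserves every `Γ(q)`**: `g ≡ I (q)` ⟹ `KgK ≡ I (q)` (so `τ` descends to `Γ(q)∖𝔥_n`: «The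
involution `τ(Z) = −Z̄` passes to an anti-holomorphic involution on `X`»). [cite: GoreskyTai2003RealModuli, §4.2 («passes to an anti-holomorphic involution on `X = Γ(N)∖𝔥_n`») and §2.3] -/
theorem conjK_mul_mul_conjK_mem_siegelPrincipalGamma {q : ℕ} {M : Matrix.symplecticGroup (Fin n) ℤ}
    (hM : M ∈ siegelPrincipalGamma n q) :
    (⟨Matrix.fromBlocks (-1 : Matrix (Fin n) (Fin n) ℤ) 0 0 (1 : Matrix (Fin n) (Fin n) ℤ) *
          (M : Matrix (Fin n ⊕ Fin n) (Fin n ⊕ Fin n) ℤ) *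
          Matrix.fromBlocks (-1 : Matrix (Fin n) (Fin n) ℤ) 0 0 (1 : Matrix (Fin n) (Fin n) ℤ),
        iStar_mul_mul_iStar_mem_symplecticGroup M.2⟩ : Matrix.symplecticGroup (Fin n) ℤ) ∈
      siegelPrincipalGamma n q := by
  rw [mem_siegelPrincipalGamma_iff_dvd] at hM ⊢
  intro i j
  change (q : ℤ) ∣ (Matrix.fromBlocks (-1 : Matrix (Fin n) (Fin n) ℤ) 0 0 (1 : Matrix (Fin n) (Fin n) ℤ) *
      (M : Matrix (Fin n ⊕ Fin n) (Fin n ⊕ Fin n) ℤ) *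
      Matrix.fromBlocks (-1 : Matrix (Fin n) (Fin n) ℤ) 0 0 (1 : Matrix (Fin n) (Fin n) ℤ) - 1) i j
  rw [conjK_mul_mul_conjK_sub_one_apply]
  exact Dvd.dvd.mul_right (Dvd.dvd.mul_left (hM i j) _) _

/-- **`−I ∉ Γ(q)` for `q ≥ 3`** (`n ≥ 1`; `(−I − I)_{11} = −2`): the element separating cocycles from
non-cocycles at `End = ℤ` points is invisible to no `Γ(q)`, `q ≥ 3` («If `m ≥ 1` the group `Γ(4m)` is
torsion-free»). [cite: GoreskyTai2003RealModuli, §4.5 proof of Lemma 12 («`θ ∈ Γ(4m)` which is torsion-free»), §8.2 («`Γ(4)` which is torsion-free») and §7.2] -/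
theorem coe_ne_neg_one_of_mem_siegelPrincipalGamma (hn : 0 < n) {q : ℕ} (hq : 3 ≤ q)
    {M : Matrix.symplecticGroup (Fin n) ℤ} (hM : M ∈ siegelPrincipalGamma n q) :
    (M : Matrix (Fin n ⊕ Fin n) (Fin n ⊕ Fin n) ℤ) ≠ -1 := by
  intro h
  rw [mem_siegelPrincipalGamma_iff_dvd] at hM
  have h2 := hM (Sum.inl ⟨0, hn⟩) (Sum.inl ⟨0, hn⟩)
  rw [h, Matrix.sub_apply, Matrix.neg_apply, Matrix.one_apply_eq] at h2
  have h3 : (q : ℤ) ∣ 2 := by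
    have : (-1 - 1 : ℤ) = -2 := by norm_num
    rw [this, dvd_neg] at h2
    exact h2
  have h4 : q ∣ 2 := by exact_mod_cast h3
  have h5 := Nat.le_of_dvd two_pos h4
  omega

/-! ## §2 Lemma 9 (1), (2): `τ(g)g⁻¹ ∈ Γ(2m)` for `g ∈ Γ(m)`, `τ(g)g ∈ Γ(4m)` for `g ∈ Γ(2m)` -/

/-- **LEMMA 9 (1), matrix form**: if `g ≡ I (mod m)` and `gg′ = I` (integral `g′`) then
`τ(g)g′ ≡ I (mod 2m)` — `τ(g)g′ − I = (τ(g) − g)g′` and `(τ(g) − g)_{ik} = (ε_iε_k − 1)(g − I)_{ik}` with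
`ε_iε_k − 1 ∈ {0, −2}` («Since `g̃ = g − (0 2B; 2C 0)` … This gives part (1)»).
[cite: GoreskyTai2003RealModuli, §4 Lemma 9 (1) and its proof] -/
theorem dvd_conjK_mul_mul_conjK_mul_sub_one_of_mul_eq_one {m : ℤ}
    {g g' : Matrix (Fin n ⊕ Fin n) (Fin n ⊕ Fin n) ℤ} (hg : ∀ i j, m ∣ (g - 1) i j) (hgg' : g * g' = 1)
    (i j : Fin n ⊕ Fin n) :
    2 * m ∣ (Matrix.fromBlocks (-1 : Matrix (Fin n) (Fin n) ℤ) 0 0 (1 : Matrix (Fin n) (Fin n) ℤ) * g *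
        Matrix.fromBlocks (-1 : Matrix (Fin n) (Fin n) ℤ) 0 0 (1 : Matrix (Fin n) (Fin n) ℤ) * g' - 1) i j := by
  have h : Matrix.fromBlocks (-1 : Matrix (Fin n) (Fin n) ℤ) 0 0 (1 : Matrix (Fin n) (Fin n) ℤ) * g *
        Matrix.fromBlocks (-1 : Matrix (Fin n) (Fin n) ℤ) 0 0 (1 : Matrix (Fin n) (Fin n) ℤ) * g' - 1 =
      (Matrix.fromBlocks (-1 : Matrix (Fin n) (Fin n) ℤ) 0 0 (1 : Matrix (Fin n) (Fin n) ℤ) * g *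
          Matrix.fromBlocks (-1 : Matrix (Fin n) (Fin n) ℤ) 0 0 (1 : Matrix (Fin n) (Fin n) ℤ) - g) * g' := by
    rw [Matrix.sub_mul, hgg']
  rw [h, Matrix.mul_apply]
  refine Finset.dvd_sum fun k _ ↦ ?_
  have e : (Matrix.fromBlocks (-1 : Matrix (Fin n) (Fin n) ℤ) 0 0 (1 : Matrix (Fin n) (Fin n) ℤ) * g *
        Matrix.fromBlocks (-1 : Matrix (Fin n) (Fin n) ℤ) 0 0 (1 : Matrix (Fin n) (Fin n) ℤ) - g) i k =
      (Sum.elim (fun _ : Fin n ↦ (-1 : ℤ)) (fun _ : Fin n ↦ (1 : ℤ)) i *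
          Sum.elim (fun _ : Fin n ↦ (-1 : ℤ)) (fun _ : Fin n ↦ (1 : ℤ)) k - 1) * (g - 1) i k := by
    rw [Matrix.sub_apply, conjK_mul_mul_conjK_apply, Matrix.sub_apply, mul_sub,
      sign_mul_sign_sub_one_mul_one_apply_g51d, sub_zero]
    ring
  rw [e]
  exact Dvd.dvd.mul_right (mul_dvd_mul (two_dvd_sign_mul_sign_sub_one_g51d i k) (hg i k)) _

/-- **LEMMA 9 (2), matrix form**: if `g ≡ I (mod 2m)` then `τ(g)g ≡ I (mod 4m)` —
`τ(g)g − I = (τ(g) − I)(g − I) + ((τ(g) − I) + (g − I))`, the first term is `≡ 0 (4m²)` and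
`((τ(g) − I) + (g − I))_{ij} = (ε_iε_j + 1)(g − I)_{ij}` with `ε_iε_j + 1 ∈ {0, 2}` («`g̃ + g` is even, and
`g̃g = I + 2m(g̃′ + g′) + 4m²g̃′g` which proves part (2)»). [cite: GoreskyTai2003RealModuli, §4 Lemma 9 (2) and its proof] -/
theorem dvd_conjK_mul_mul_conjK_mul_self_sub_one {m : ℤ} {g : Matrix (Fin n ⊕ Fin n) (Fin n ⊕ Fin n) ℤ}
    (hg : ∀ i j, 2 * m ∣ (g - 1) i j) (i j : Fin n ⊕ Fin n) :
    4 * m ∣ (Matrix.fromBlocks (-1 : Matrix (Fin n) (Fin n) ℤ) 0 0 (1 : Matrix (Fin n) (Fin n) ℤ) * g *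
        Matrix.fromBlocks (-1 : Matrix (Fin n) (Fin n) ℤ) 0 0 (1 : Matrix (Fin n) (Fin n) ℤ) * g - 1) i j := by
  have h : Matrix.fromBlocks (-1 : Matrix (Fin n) (Fin n) ℤ) 0 0 (1 : Matrix (Fin n) (Fin n) ℤ) * g *
        Matrix.fromBlocks (-1 : Matrix (Fin n) (Fin n) ℤ) 0 0 (1 : Matrix (Fin n) (Fin n) ℤ) * g - 1 =
      (Matrix.fromBlocks (-1 : Matrix (Fin n) (Fin n) ℤ) 0 0 (1 : Matrix (Fin n) (Fin n) ℤ) * g *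
            Matrix.fromBlocks (-1 : Matrix (Fin n) (Fin n) ℤ) 0 0 (1 : Matrix (Fin n) (Fin n) ℤ) - 1) * (g - 1) +
        ((Matrix.fromBlocks (-1 : Matrix (Fin n) (Fin n) ℤ) 0 0 (1 : Matrix (Fin n) (Fin n) ℤ) * g *
            Matrix.fromBlocks (-1 : Matrix (Fin n) (Fin n) ℤ) 0 0 (1 : Matrix (Fin n) (Fin n) ℤ) - 1) + (g - 1)) := by
    noncomm_ring
  rw [h, Matrix.add_apply, Matrix.add_apply]
  refine dvd_add ?_ ?_
  · -- the product term: each summand is divisible by `(2m)(2m)`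
    rw [Matrix.mul_apply]
    refine Finset.dvd_sum fun k _ ↦ ?_
    have h1 : 2 * m ∣ (Matrix.fromBlocks (-1 : Matrix (Fin n) (Fin n) ℤ) 0 0 (1 : Matrix (Fin n) (Fin n) ℤ) * g *
        Matrix.fromBlocks (-1 : Matrix (Fin n) (Fin n) ℤ) 0 0 (1 : Matrix (Fin n) (Fin n) ℤ) - 1) i k := by
      rw [conjK_mul_mul_conjK_sub_one_apply]
      exact Dvd.dvd.mul_right (Dvd.dvd.mul_left (hg i k) _) _
    have h44 : 4 * m ∣ 2 * m * (2 * m) := ⟨m, by ring⟩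
    exact h44.trans (mul_dvd_mul h1 (hg k j))
  · rw [conjK_mul_mul_conjK_sub_one_apply, Matrix.sub_apply g]
    have e : Sum.elim (fun _ : Fin n ↦ (-1 : ℤ)) (fun _ : Fin n ↦ (1 : ℤ)) i * (g i j - (1 : Matrix _ _ ℤ) i j) *
          Sum.elim (fun _ : Fin n ↦ (-1 : ℤ)) (fun _ : Fin n ↦ (1 : ℤ)) j + (g i j - (1 : Matrix _ _ ℤ) i j) =
        (Sum.elim (fun _ : Fin n ↦ (-1 : ℤ)) (fun _ : Fin n ↦ (1 : ℤ)) i *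
            Sum.elim (fun _ : Fin n ↦ (-1 : ℤ)) (fun _ : Fin n ↦ (1 : ℤ)) j + 1) * (g - 1) i j := by
      rw [Matrix.sub_apply]
      ring
    rw [e, show (4 : ℤ) * m = 2 * (2 * m) by ring]
    exact mul_dvd_mul (two_dvd_sign_mul_sign_add_one_g51d i j) (hg i j)

/-- **LEMMA 9 (1).**  `g ∈ Γ(m)` ⟹ `τ(g)g⁻¹ ∈ Γ(2m)` in `Sp_{2n}(ℤ)`. [cite: GoreskyTai2003RealModuli, §4 Lemma 9 (1)] -/
theorem conjK_mul_inv_mem_siegelPrincipalGamma {m : ℕ} {M : Matrix.symplecticGroup (Fin n) ℤ}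
    (hM : M ∈ siegelPrincipalGamma n m) :
    (⟨Matrix.fromBlocks (-1 : Matrix (Fin n) (Fin n) ℤ) 0 0 (1 : Matrix (Fin n) (Fin n) ℤ) *
          (M : Matrix (Fin n ⊕ Fin n) (Fin n ⊕ Fin n) ℤ) *
          Matrix.fromBlocks (-1 : Matrix (Fin n) (Fin n) ℤ) 0 0 (1 : Matrix (Fin n) (Fin n) ℤ),
        iStar_mul_mul_iStar_mem_symplecticGroup M.2⟩ : Matrix.symplecticGroup (Fin n) ℤ) * M⁻¹ ∈
      siegelPrincipalGamma n (2 * m) := by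
  rw [mem_siegelPrincipalGamma_iff_dvd] at hM ⊢
  have hMM : (M : Matrix (Fin n ⊕ Fin n) (Fin n ⊕ Fin n) ℤ) *
      ((M⁻¹ : Matrix.symplecticGroup (Fin n) ℤ) : Matrix (Fin n ⊕ Fin n) (Fin n ⊕ Fin n) ℤ) = 1 := by
    rw [← Submonoid.coe_mul, mul_inv_cancel]; rfl
  intro i j
  push_cast
  exact dvd_conjK_mul_mul_conjK_mul_sub_one_of_mul_eq_one hM hMM i j

/-- **LEMMA 9 (2).**  `g ∈ Γ(2m)` ⟹ `τ(g)g ∈ Γ(4m)` in `Sp_{2n}(ℤ)`. [cite: GoreskyTai2003RealModuli, §4 Lemma 9 (2)] -/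
theorem conjK_mul_self_mem_siegelPrincipalGamma {m : ℕ} {M : Matrix.symplecticGroup (Fin n) ℤ}
    (hM : M ∈ siegelPrincipalGamma n (2 * m)) :
    (⟨Matrix.fromBlocks (-1 : Matrix (Fin n) (Fin n) ℤ) 0 0 (1 : Matrix (Fin n) (Fin n) ℤ) *
          (M : Matrix (Fin n ⊕ Fin n) (Fin n ⊕ Fin n) ℤ) *
          Matrix.fromBlocks (-1 : Matrix (Fin n) (Fin n) ℤ) 0 0 (1 : Matrix (Fin n) (Fin n) ℤ),
        iStar_mul_mul_iStar_mem_symplecticGroup M.2⟩ : Matrix.symplecticGroup (Fin n) ℤ) * M ∈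
      siegelPrincipalGamma n (4 * m) := by
  rw [mem_siegelPrincipalGamma_iff_dvd] at hM ⊢
  intro i j
  push_cast at hM ⊢
  exact dvd_conjK_mul_mul_conjK_mul_self_sub_one hM i j

/-- **`g ∈ Γ(2)` ⟹ `τ(g)g ≠ −I`** (`n ≥ 1`): `τ(g)g ∈ Γ(4)` and `−I ∉ Γ(4)` — the sign `−1` of Shimura's
`𝔜_j` cannot occur for a `Γ(2)`-matrix. [cite: GoreskyTai2003RealModuli, §4 Lemma 9 (2) and §7.2 («`±T_{−2X} … ∈ Γ(2).Γ(4m)` … So `2X` is "even"»)] -/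
theorem conjK_mul_self_ne_neg_one_of_level_two (hn : 0 < n) {M : Matrix.symplecticGroup (Fin n) ℤ}
    (hM : M ∈ siegelPrincipalGamma n 2) :
    Matrix.fromBlocks (-1 : Matrix (Fin n) (Fin n) ℤ) 0 0 (1 : Matrix (Fin n) (Fin n) ℤ) *
          (M : Matrix (Fin n ⊕ Fin n) (Fin n ⊕ Fin n) ℤ) *
          Matrix.fromBlocks (-1 : Matrix (Fin n) (Fin n) ℤ) 0 0 (1 : Matrix (Fin n) (Fin n) ℤ) *
        (M : Matrix (Fin n ⊕ Fin n) (Fin n ⊕ Fin n) ℤ) ≠ -1 := by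
  have h4 := conjK_mul_self_mem_siegelPrincipalGamma (m := 1) (by simpa using hM)
  exact coe_ne_neg_one_of_mem_siegelPrincipalGamma hn (by norm_num) h4

/-! ## §3 The moduli consequence: `Γ_g(2)`-real points with `Stab_{Γ_g}(Z) = ±1` are cocycle points -/

section Moduli

variable {g : ℕ} (hδ : ∀ i, 0 < (1 : Fin g → ℕ) i) {Z : Matrix (Fin g) (Fin g) ℂ} (hZ : Z ∈ siegelUpperHalfSpace g)

/-- `τ(ι(γ))·ι(γ) = ι(τ(γ)γ)` on real matrices (`ι : Sp_{2g}(ℤ) → Sp_{2g}(ℝ)` the tree's `symplecticIntHom`).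
[cite: GoreskyTai2003RealModuli, §2.2] -/
theorem iStar_mul_symplecticIntHom_mul_iStar_mul_self (γ : Matrix.symplecticGroup (Fin g) ℤ) :
    Matrix.fromBlocks (-1 : Matrix (Fin g) (Fin g) ℝ) 0 0 (1 : Matrix (Fin g) (Fin g) ℝ) *
          ((symplecticIntHom g γ : Matrix.symplecticGroup (Fin g) ℝ) : Matrix (Fin g ⊕ Fin g) (Fin g ⊕ Fin g) ℝ) *
          Matrix.fromBlocks (-1 : Matrix (Fin g) (Fin g) ℝ) 0 0 (1 : Matrix (Fin g) (Fin g) ℝ) *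
        ((symplecticIntHom g γ : Matrix.symplecticGroup (Fin g) ℝ) : Matrix (Fin g ⊕ Fin g) (Fin g ⊕ Fin g) ℝ) =
      (Matrix.fromBlocks (-1 : Matrix (Fin g) (Fin g) ℤ) 0 0 (1 : Matrix (Fin g) (Fin g) ℤ) *
            (γ : Matrix (Fin g ⊕ Fin g) (Fin g ⊕ Fin g) ℤ) *
            Matrix.fromBlocks (-1 : Matrix (Fin g) (Fin g) ℤ) 0 0 (1 : Matrix (Fin g) (Fin g) ℤ) *
          (γ : Matrix (Fin g ⊕ Fin g) (Fin g ⊕ Fin g) ℤ)).map (Int.castRingHom ℝ) := by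
  change Matrix.fromBlocks (-1 : Matrix (Fin g) (Fin g) ℝ) 0 0 (1 : Matrix (Fin g) (Fin g) ℝ) *
        (γ : Matrix (Fin g ⊕ Fin g) (Fin g ⊕ Fin g) ℤ).map (Int.castRingHom ℝ) *
        Matrix.fromBlocks (-1 : Matrix (Fin g) (Fin g) ℝ) 0 0 (1 : Matrix (Fin g) (Fin g) ℝ) *
      (γ : Matrix (Fin g ⊕ Fin g) (Fin g ⊕ Fin g) ℤ).map (Int.castRingHom ℝ) = _
  rw [Matrix.map_mul, Matrix.map_mul, Matrix.map_mul, conjK_map_castRingHom_g51d]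

/-- **A `Γ_g(2)`-REAL POINT WITH `Stab_{Γ_g}(Z) = ±1` IS A COCYCLE POINT.**  If `Z ∈ 𝔥_g` (`g ≥ 1`) is «not
fixed by any element of `Sp(2g, ℤ)` other than `±I`», `γ ∈ Γ_g(2)` and `γ • Z = −Z̄`, then
`τ(γ)·γ = 1`: `τ(γ)γ` fixes `Z` (g50-#7), so it is `±I`, and `τ(γ)γ ∈ Γ(4) ∌ −I` (Lemma 9 (2)) — the sign
decision «`±T_{−2X} ∈ Γ(2).Γ(4m)` … So `2X` is "even"» of §7.2, i.e. the minus sign of Shimura's `𝔜_j`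
never occurs at level `2`. [cite: GoreskyTai2003RealModuli, §4 Lemma 9 (2), Prop. 10 and §7.2] -/
theorem iStar_mul_self_eq_one_of_mem_siegelPrincipalGamma_two (hg : 0 < g)
    (hstab : ∀ P ∈ siegelModularGroup g, P • (⟨Z, hZ⟩ : siegelUpperHalfSpace g) = ⟨Z, hZ⟩ →
      (P : Matrix (Fin g ⊕ Fin g) (Fin g ⊕ Fin g) ℝ) = 1 ∨ (P : Matrix (Fin g ⊕ Fin g) (Fin g ⊕ Fin g) ℝ) = -1)
    {γ : Matrix.symplecticGroup (Fin g) ℤ} (hγ : γ ∈ siegelPrincipalGamma g 2)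
    (hsmul : symplecticIntHom g γ • (⟨Z, hZ⟩ : siegelUpperHalfSpace g) =
      ⟨-Z.map conj, neg_map_conj_mem_siegelUpperHalfSpace hZ⟩) :
    Matrix.fromBlocks (-1 : Matrix (Fin g) (Fin g) ℝ) 0 0 (1 : Matrix (Fin g) (Fin g) ℝ) *
          ((symplecticIntHom g γ : Matrix.symplecticGroup (Fin g) ℝ) : Matrix (Fin g ⊕ Fin g) (Fin g ⊕ Fin g) ℝ) *
          Matrix.fromBlocks (-1 : Matrix (Fin g) (Fin g) ℝ) 0 0 (1 : Matrix (Fin g) (Fin g) ℝ) *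
        ((symplecticIntHom g γ : Matrix.symplecticGroup (Fin g) ℝ) : Matrix (Fin g ⊕ Fin g) (Fin g ⊕ Fin g) ℝ) = 1 := by
  have hfix := iStar_mul_self_smul_eq_self_of_smul_eq_negConj (symplecticIntHom g γ) ⟨Z, hZ⟩ hsmul
  have hx : symplecticIntHom g γ ∈ siegelModularGroup g := ⟨γ, rfl⟩
  have hmem : (⟨Matrix.fromBlocks (-1 : Matrix (Fin g) (Fin g) ℝ) 0 0 (1 : Matrix (Fin g) (Fin g) ℝ) *
        ((symplecticIntHom g γ : Matrix.symplecticGroup (Fin g) ℝ) : Matrix (Fin g ⊕ Fin g) (Fin g ⊕ Fin g) ℝ) *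
        Matrix.fromBlocks (-1 : Matrix (Fin g) (Fin g) ℝ) 0 0 (1 : Matrix (Fin g) (Fin g) ℝ),
      iStar_mul_mul_iStar_mem_symplecticGroup (symplecticIntHom g γ).2⟩ : Matrix.symplecticGroup (Fin g) ℝ) *
        symplecticIntHom g γ ∈ siegelModularGroup g :=
    (siegelModularGroup g).mul_mem (iStar_mul_mul_iStar_mem_siegelModularGroup hx) hx
  rcases hstab _ hmem hfix with h | h
  · exact h
  · exfalso
    have h' : Matrix.fromBlocks (-1 : Matrix (Fin g) (Fin g) ℝ) 0 0 (1 : Matrix (Fin g) (Fin g) ℝ) *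
          ((symplecticIntHom g γ : Matrix.symplecticGroup (Fin g) ℝ) : Matrix (Fin g ⊕ Fin g) (Fin g ⊕ Fin g) ℝ) *
          Matrix.fromBlocks (-1 : Matrix (Fin g) (Fin g) ℝ) 0 0 (1 : Matrix (Fin g) (Fin g) ℝ) *
        ((symplecticIntHom g γ : Matrix.symplecticGroup (Fin g) ℝ) : Matrix (Fin g ⊕ Fin g) (Fin g ⊕ Fin g) ℝ) = -1 := h
    rw [iStar_mul_symplecticIntHom_mul_iStar_mul_self] at h'
    apply conjK_mul_self_ne_neg_one_of_level_two hg hγ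
    refine Matrix.map_injective (Int.castRingHom ℝ).injective_int (h'.trans ?_)
    show (-1 : Matrix (Fin g ⊕ Fin g) (Fin g ⊕ Fin g) ℝ) =
      (-1 : Matrix (Fin g ⊕ Fin g) (Fin g ⊕ Fin g) ℤ).map (Int.castRingHom ℝ)
    rw [Matrix.map_neg _ (map_neg (Int.castRingHom ℝ)), Matrix.map_one _ (map_zero _) (map_one _)]

variable (hEnd : ∀ M : Matrix (Fin g ⊕ Fin g) (Fin g ⊕ Fin g) ℤ,
    (∀ x, (M.map (Int.cast : ℤ → ℝ)) *ᵥ latticeJ (siegelPeriodEquiv hδ hZ) x =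
      latticeJ (siegelPeriodEquiv hδ hZ) ((M.map (Int.cast : ℤ → ℝ)) *ᵥ x)) → ∃ c : ℤ, M = c • 1)

include hEnd in
/-- **`End(X_Z) = ℤ`, `γ ∈ Γ_g(2)`, `γ • Z = −Z̄` ⟹ `τ(γ)γ = 1`** (isotropy `±1` from g51-#3 §1).
[cite: GoreskyTai2003RealModuli, §4 Prop. 10 and §7.2] [cite: Shimura1972FieldOfRationality, §3 Prop. 12 (hypothesis «no automorphisms other than `±1`»), p. 176] -/
theorem iStar_mul_self_eq_one_of_mem_siegelPrincipalGamma_two_of_end_eq_smul_one (hg : 0 < g)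
    {γ : Matrix.symplecticGroup (Fin g) ℤ} (hγ : γ ∈ siegelPrincipalGamma g 2)
    (hsmul : symplecticIntHom g γ • (⟨Z, hZ⟩ : siegelUpperHalfSpace g) =
      ⟨-Z.map conj, neg_map_conj_mem_siegelUpperHalfSpace hZ⟩) :
    Matrix.fromBlocks (-1 : Matrix (Fin g) (Fin g) ℝ) 0 0 (1 : Matrix (Fin g) (Fin g) ℝ) *
          ((symplecticIntHom g γ : Matrix.symplecticGroup (Fin g) ℝ) : Matrix (Fin g ⊕ Fin g) (Fin g ⊕ Fin g) ℝ) *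
          Matrix.fromBlocks (-1 : Matrix (Fin g) (Fin g) ℝ) 0 0 (1 : Matrix (Fin g) (Fin g) ℝ) *
        ((symplecticIntHom g γ : Matrix.symplecticGroup (Fin g) ℝ) : Matrix (Fin g ⊕ Fin g) (Fin g ⊕ Fin g) ℝ) = 1 :=
  iStar_mul_self_eq_one_of_mem_siegelPrincipalGamma_two hZ hg
    (fun _ hP hPZ ↦ (smul_eq_self_iff_of_end_eq_smul_one_of_mem_siegelModularGroup hδ hZ hEnd hg hP).1 hPZ) hγ hsmul

include hEnd in
/-- **Prop. 10 / Cor. 11 in moduli form, real-structure half**: `End(X_Z) = ℤ`, `γ ∈ Γ_g(2)`, `γ • Z = −Z̄`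
⟹ `(X_Z, E_Z)` admits an `E_Z`-compatible real structure (Goresky–Tai's `κ(γ, Z)`, g51-#1).
[cite: GoreskyTai2003RealModuli, §4 Prop. 10, Cor. 11, §6.3 and §7.2] -/
theorem exists_realStructure_siegelForm_real_of_mem_siegelPrincipalGamma_two_of_end_eq_smul_one (hg : 0 < g)
    {γ : Matrix.symplecticGroup (Fin g) ℤ} (hγ : γ ∈ siegelPrincipalGamma g 2)
    (hsmul : symplecticIntHom g γ • (⟨Z, hZ⟩ : siegelUpperHalfSpace g) =
      ⟨-Z.map conj, neg_map_conj_mem_siegelUpperHalfSpace hZ⟩) :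
    ∃ (S : RealStructure 𝓘(ℂ, Fin g → ℂ) (ComplexTorus (siegelPeriodEquiv hδ hZ)))
      (A : Matrix (Fin g ⊕ Fin g) (Fin g ⊕ Fin g) ℤ),
      (∀ t, S t = mapMatrix (siegelPeriodEquiv hδ hZ) (siegelPeriodEquiv hδ hZ) A t + S 0) ∧
        Aᵀ * typeForm (1 : Fin g → ℕ) * A = -typeForm (1 : Fin g → ℕ) :=
  (exists_realStructure_siegelForm_real_iff_exists_cocycle hδ hZ).2 ⟨symplecticIntHom g γ, ⟨γ, rfl⟩, hsmul,
    Subtype.ext (iStar_mul_self_eq_one_of_mem_siegelPrincipalGamma_two_of_end_eq_smul_one hδ hZ hEnd hg hγ hsmul)⟩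

include hEnd in
/-- **Prop. 10 in moduli form, Comessatti half**: `End(X_Z) = ℤ`, `γ ∈ Γ_g(2)`, `γ • Z = −Z̄` ⟹ `Z` is
`Γ_g`-equivalent to some `X + iY` with `2X ∈ Sym_g(ℤ)` («By Comessatti's lemma, `Z` is equivalent (via some
`h ∈ Sp(2n, ℤ)`) to some element `X + iY ∈ 𝔥_n` with `2X ∈ M_{n×n}(ℤ)`» — legitimately, the cocycle
condition being automatic at level `2`; g51-#2). [cite: GoreskyTai2003RealModuli, §4 Prop. 10 and §7.2, §7 Lemma 20 (A)] -/
theorem exists_smul_two_mul_re_of_mem_siegelPrincipalGamma_two_of_end_eq_smul_one (hg : 0 < g)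
    {γ : Matrix.symplecticGroup (Fin g) ℤ} (hγ : γ ∈ siegelPrincipalGamma g 2)
    (hsmul : symplecticIntHom g γ • (⟨Z, hZ⟩ : siegelUpperHalfSpace g) =
      ⟨-Z.map conj, neg_map_conj_mem_siegelUpperHalfSpace hZ⟩) :
    ∃ y ∈ siegelModularGroup g, ∃ N : Matrix (Fin g) (Fin g) ℤ, Nᵀ = N ∧
      ∀ i k, 2 * (((y • (⟨Z, hZ⟩ : siegelUpperHalfSpace g) : siegelUpperHalfSpace g) :
        Matrix (Fin g) (Fin g) ℂ) i k).re = (N i k : ℝ) :=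
  exists_smul_two_mul_re_of_cocycle hδ hZ ⟨γ, rfl⟩ hsmul
    (Subtype.ext (iStar_mul_self_eq_one_of_mem_siegelPrincipalGamma_two_of_end_eq_smul_one hδ hZ hEnd hg hγ hsmul))

include hδ in
/-- **Hodge-general version** (`Z ∉ 𝒩_Hg`, the tree's «generic»): `γ ∈ Γ_g(2)`, `γ • Z = −Z̄` ⟹
`τ(γ)γ = 1`. [cite: GoreskyTai2003RealModuli, §4 Prop. 10 and §7.2] [cite: Lange2023AbelianVarietiesComplex, §7.3.1 Prop. 7.3.2] -/
theorem iStar_mul_self_eq_one_of_mem_siegelPrincipalGamma_two_of_hodgeGeneral (hg : 0 < g)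
    (hgen : (⟨Z, hZ⟩ : siegelUpperHalfSpace g) ∉ hodgeGroupExceptionalLocus g)
    {γ : Matrix.symplecticGroup (Fin g) ℤ} (hγ : γ ∈ siegelPrincipalGamma g 2)
    (hsmul : symplecticIntHom g γ • (⟨Z, hZ⟩ : siegelUpperHalfSpace g) =
      ⟨-Z.map conj, neg_map_conj_mem_siegelUpperHalfSpace hZ⟩) :
    Matrix.fromBlocks (-1 : Matrix (Fin g) (Fin g) ℝ) 0 0 (1 : Matrix (Fin g) (Fin g) ℝ) *
          ((symplecticIntHom g γ : Matrix.symplecticGroup (Fin g) ℝ) : Matrix (Fin g ⊕ Fin g) (Fin g ⊕ Fin g) ℝ) *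
          Matrix.fromBlocks (-1 : Matrix (Fin g) (Fin g) ℝ) 0 0 (1 : Matrix (Fin g) (Fin g) ℝ) *
        ((symplecticIntHom g γ : Matrix.symplecticGroup (Fin g) ℝ) : Matrix (Fin g ⊕ Fin g) (Fin g ⊕ Fin g) ℝ) = 1 :=
  iStar_mul_self_eq_one_of_mem_siegelPrincipalGamma_two_of_end_eq_smul_one hδ hZ
    (end_eq_smul_one_of_not_mem_hodgeGroupExceptionalLocus hδ hZ hgen) hg hγ hsmul

/-- **Hodge-general version, real structure and `Γ_g · H'_g`**: `Z ∉ 𝒩_Hg`, `γ ∈ Γ_g(2)`, `γ • Z = −Z̄` ⟹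
`(X_Z, E_Z)` is real with `E_Z` real, and `Z ∈ Γ_g · H'_g`. [cite: GoreskyTai2003RealModuli, §4 Prop. 10, Cor. 11 and §7.2] -/
theorem exists_realStructure_siegelForm_real_and_exists_smul_two_mul_re_of_mem_siegelPrincipalGamma_two_of_hodgeGeneral
    (hg : 0 < g) (hgen : (⟨Z, hZ⟩ : siegelUpperHalfSpace g) ∉ hodgeGroupExceptionalLocus g)
    {γ : Matrix.symplecticGroup (Fin g) ℤ} (hγ : γ ∈ siegelPrincipalGamma g 2)
    (hsmul : symplecticIntHom g γ • (⟨Z, hZ⟩ : siegelUpperHalfSpace g) =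
      ⟨-Z.map conj, neg_map_conj_mem_siegelUpperHalfSpace hZ⟩) :
    (∃ (S : RealStructure 𝓘(ℂ, Fin g → ℂ) (ComplexTorus (siegelPeriodEquiv hδ hZ)))
        (A : Matrix (Fin g ⊕ Fin g) (Fin g ⊕ Fin g) ℤ),
        (∀ t, S t = mapMatrix (siegelPeriodEquiv hδ hZ) (siegelPeriodEquiv hδ hZ) A t + S 0) ∧
          Aᵀ * typeForm (1 : Fin g → ℕ) * A = -typeForm (1 : Fin g → ℕ)) ∧
      ∃ y ∈ siegelModularGroup g, ∃ N : Matrix (Fin g) (Fin g) ℤ, Nᵀ = N ∧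
        ∀ i k, 2 * (((y • (⟨Z, hZ⟩ : siegelUpperHalfSpace g) : siegelUpperHalfSpace g) :
          Matrix (Fin g) (Fin g) ℂ) i k).re = (N i k : ℝ) :=
  ⟨exists_realStructure_siegelForm_real_of_mem_siegelPrincipalGamma_two_of_end_eq_smul_one hδ hZ
      (end_eq_smul_one_of_not_mem_hodgeGroupExceptionalLocus hδ hZ hgen) hg hγ hsmul,
    exists_smul_two_mul_re_of_mem_siegelPrincipalGamma_two_of_end_eq_smul_one hδ hZ
      (end_eq_smul_one_of_not_mem_hodgeGroupExceptionalLocus hδ hZ hgen) hg hγ hsmul⟩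

/-! ## §4 Shimura's points are not `Γ_g(2)`-real -/

include hEnd in
/-- **ON `𝔜_j` NO `γ ∈ Γ_g(2)` CARRIES `Z` TO `−Z̄`** (`j² = −1`, `ᵗj = −j`, `jZ = −Z̄j`, `End(X_Z) = ℤ`, `g ≥ 1`):
there every `x ∈ Γ_g` with `x • Z = −Z̄` has `τ(x)x = −1` (g51-#3), while a level-`2` one would have
`τ(γ)γ = 1` (§3).  So Shimura's real points of `𝔄_g` without real model do not lift to real points of
`Γ_g(2)∖𝔥_g` — consistent with Theorem 8: at level `4m` every real point comes from a real abelian variety.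
[cite: GoreskyTai2003RealModuli, §4 Thm. 8, Lemma 9 (2), Cor. 11] [cite: Shimura1972FieldOfRationality, §3 Prop. 10, Prop. 12, Thm. 2, pp. 174–177] [cite: Silhol1989, Ch. IV §4, p. 58] -/
theorem not_exists_mem_siegelPrincipalGamma_two_smul_eq_negConj_of_blockRel (hg : 0 < g)
    {j : Matrix (Fin g) (Fin g) ℤ} (hjj : j * j = -1) (hjT : jᵀ = -j)
    (hjZ : j.map (Int.cast : ℤ → ℂ) * Z = -Z.map conj * j.map (Int.cast : ℤ → ℂ)) :
    ¬ ∃ γ ∈ siegelPrincipalGamma g 2, symplecticIntHom g γ • (⟨Z, hZ⟩ : siegelUpperHalfSpace g) =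
        ⟨-Z.map conj, neg_map_conj_mem_siegelUpperHalfSpace hZ⟩ := by
  rintro ⟨γ, hγ, hsmul⟩
  have h1 := iStar_mul_self_eq_one_of_mem_siegelPrincipalGamma_two_of_end_eq_smul_one hδ hZ hEnd hg hγ hsmul
  rw [iStar_mul_self_eq_neg_one_of_blockRel hδ hZ hEnd hg hjj hjT hjZ ⟨γ, rfl⟩ hsmul] at h1
  have h2 := congrFun (congrFun h1 (Sum.inl ⟨0, hg⟩)) (Sum.inl ⟨0, hg⟩)
  rw [Matrix.neg_apply, Matrix.one_apply_eq] at h2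
  norm_num at h2

end Moduli

end SiegelModuli

end Literature.AlgebraicGeometry.ModuliOfAbelianVarieties
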